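import Mathlib

/-!
# SoloBlind — weighted gain algebra and the κ-cell resolvent lemma (ENGINE L, PLAN §121.15)

The certificates of LEMMA P are *weighted Schur tests*: a matrix `A` has gain `q` for positive
weights `w` when `∑ j, ‖A m j‖ * w j ≤ q * w m` for every row `m` (the operator norm induced by
`‖x‖ = max |x j| / w j`).  ENGINE L certifies the gain of the loop matrix `G_s H G_r` at one value
`κ_c` of the edge parameter; the whole κ-cell is then covered by algebra, because changing `κ`
shifts both tridiagonal operators by a multiple of the identity, `T' = T + μ • 1`.  This file proves

* `Gain` and its calculus: `gain_mono`, `gain_add`, `gain_neg`, `gain_sub`, `gain_smul`,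
  `row_mul_le`, `gain_mul` (submultiplicativity);
* `resolvent_left` / `resolvent_right` : `G' = G - μ • (G' G)` resp. `G' = G - μ • (G G')`;
* `gain_resolvent` : if `T G = 1`, `G' (T + μ•1) = 1`, `Gain w G γ` and `‖μ‖ γ ≤ a < 1` then
  `Gain w G' (γ / (1 - a))` — a self-referential row estimate, no Neumann series;
* `gain_resolvent_diff_mul` : `Gain w (G A) α → Gain w ((G' - G) A) (a/(1-a) · α)`;
* `gain_mul_resolvent_diff` : `Gain w (A G) α → Gain w (A (G' - G)) (α · (a/(1-a)))`.

With `q` the certified gain of `G_s H G_r` these give the κ-cell factor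
`gain (G_s' H G_r' - G_s H G_r) ≤ q · (a_s/((1-a_s)(1-a_r)) + a_r/(1-a_r))` used by the engine.
-/

namespace Summit.AnomalousDissipation.SoloBlind.GainAlgebra

open Finset Matrix

variable {n : ℕ}

/-- Weighted row-sum gain (Schur test): `∑ j, ‖A m j‖ w j ≤ q w m` for every row. -/
def Gain (w : Fin n → ℝ) (A : Matrix (Fin n) (Fin n) ℂ) (q : ℝ) : Prop :=
  ∀ m, ∑ j, ‖A m j‖ * w j ≤ q * w m

variable {w : Fin n → ℝ} {A B : Matrix (Fin n) (Fin n) ℂ} {α β : ℝ}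

/-- Monotonicity of the gain bound in `q`. -/
theorem gain_mono (hw : ∀ m, 0 < w m) (hA : Gain w A α) (h : α ≤ β) : Gain w A β :=
  fun m => (hA m).trans (mul_le_mul_of_nonneg_right h (hw m).le)

/-- Gain of a sum. -/
theorem gain_add (hw : ∀ m, 0 < w m) (hA : Gain w A α) (hB : Gain w B β) :
    Gain w (A + B) (α + β) := by
  intro m
  calc ∑ j, ‖(A + B) m j‖ * w j ≤ ∑ j, (‖A m j‖ + ‖B m j‖) * w j := by
        refine sum_le_sum fun j _ => ?_
        rw [Matrix.add_apply]
        exact mul_le_mul_of_nonneg_right (norm_add_le _ _) (hw j).le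
    _ = ∑ j, ‖A m j‖ * w j + ∑ j, ‖B m j‖ * w j := by
        rw [← sum_add_distrib]; exact sum_congr rfl fun j _ => by ring
    _ ≤ α * w m + β * w m := add_le_add (hA m) (hB m)
    _ = (α + β) * w m := by ring

/-- Gain is invariant under negation. -/
theorem gain_neg (hA : Gain w A α) : Gain w (-A) α := by
  intro m; simpa [Matrix.neg_apply, norm_neg] using hA m

/-- Gain of a difference. -/
theorem gain_sub (hw : ∀ m, 0 < w m) (hA : Gain w A α) (hB : Gain w B β) :
    Gain w (A - B) (α + β) := by
  have := gain_add hw hA (gain_neg hB)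
  simpa [sub_eq_add_neg] using this

/-- Gain of a scalar multiple. -/
theorem gain_smul (hA : Gain w A α) (c : ℂ) : Gain w (c • A) (‖c‖ * α) := by
  intro m
  calc ∑ j, ‖(c • A) m j‖ * w j = ‖c‖ * ∑ j, ‖A m j‖ * w j := by
        rw [mul_sum]; refine sum_congr rfl fun j _ => ?_
        rw [Matrix.smul_apply, smul_eq_mul, norm_mul]; ring
    _ ≤ ‖c‖ * (α * w m) := mul_le_mul_of_nonneg_left (hA m) (norm_nonneg c)
    _ = ‖c‖ * α * w m := by ring

/-- Row estimate for a product: `∑ j ‖(A B) m j‖ w j ≤ β ∑ k ‖A m k‖ w k` when `B` has gain `β`. -/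
theorem row_mul_le (hw : ∀ m, 0 < w m) (hB : Gain w B β) (m : Fin n) :
    ∑ j, ‖(A * B) m j‖ * w j ≤ β * ∑ k, ‖A m k‖ * w k := by
  calc ∑ j, ‖(A * B) m j‖ * w j
        ≤ ∑ j, (∑ k, ‖A m k‖ * ‖B k j‖) * w j := by
          refine sum_le_sum fun j _ => ?_
          rw [Matrix.mul_apply]
          have hle : ‖∑ k, A m k * B k j‖ ≤ ∑ k, ‖A m k‖ * ‖B k j‖ :=
            (norm_sum_le _ _).trans (le_of_eq (sum_congr rfl fun k _ => norm_mul _ _))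
          exact mul_le_mul_of_nonneg_right hle (hw j).le
    _ = ∑ j, ∑ k, ‖A m k‖ * (‖B k j‖ * w j) := by
          refine sum_congr rfl fun j _ => ?_
          rw [sum_mul]
          exact sum_congr rfl fun k _ => by ring
    _ = ∑ k, ∑ j, ‖A m k‖ * (‖B k j‖ * w j) := sum_comm
    _ = ∑ k, ‖A m k‖ * (∑ j, ‖B k j‖ * w j) := by
          refine sum_congr rfl fun k _ => ?_
          rw [mul_sum]
    _ ≤ ∑ k, ‖A m k‖ * (β * w k) :=
          sum_le_sum fun k _ => mul_le_mul_of_nonneg_left (hB k) (norm_nonneg _)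
    _ = β * ∑ k, ‖A m k‖ * w k := by
          rw [mul_sum]; refine sum_congr rfl fun k _ => by ring

/-- Submultiplicativity of the weighted gain. -/
theorem gain_mul (hw : ∀ m, 0 < w m) (hA : Gain w A α) (hB : Gain w B β) (hβ : 0 ≤ β) :
    Gain w (A * B) (α * β) := by
  intro m
  calc ∑ j, ‖(A * B) m j‖ * w j ≤ β * ∑ k, ‖A m k‖ * w k := row_mul_le hw hB m
    _ ≤ β * (α * w m) := mul_le_mul_of_nonneg_left (hA m) hβ
    _ = α * β * w m := by ring

variable {T G G' : Matrix (Fin n) (Fin n) ℂ} {μ : ℂ} {γ a : ℝ}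

/-- Resolvent identity (left form): `T G = 1` and `G' (T + μ•1) = 1` give `G' = G - μ • (G' G)`. -/
theorem resolvent_left (hT : T * G = 1)
    (hG' : G' * (T + μ • (1 : Matrix (Fin n) (Fin n) ℂ)) = 1) : G' = G - μ • (G' * G) := by
  have h : G' * (T + μ • (1 : Matrix (Fin n) (Fin n) ℂ)) * G = G := by rw [hG', Matrix.one_mul]
  rw [Matrix.mul_assoc, Matrix.add_mul, hT, Matrix.smul_mul, Matrix.one_mul, Matrix.mul_add,
    Matrix.mul_one, Matrix.mul_smul] at h
  exact eq_sub_of_add_eq h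

/-- Resolvent identity (right form): `G T = 1` and `(T + μ•1) G' = 1` give `G' = G - μ • (G G')`. -/
theorem resolvent_right (hT : G * T = 1)
    (hG' : (T + μ • (1 : Matrix (Fin n) (Fin n) ℂ)) * G' = 1) : G' = G - μ • (G * G') := by
  have h : G * ((T + μ • (1 : Matrix (Fin n) (Fin n) ℂ)) * G') = G := by rw [hG', Matrix.mul_one]
  rw [← Matrix.mul_assoc, Matrix.mul_add, hT, Matrix.mul_smul, Matrix.mul_one, Matrix.add_mul,
    Matrix.one_mul, Matrix.smul_mul] at h
  exact eq_sub_of_add_eq h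

/-- κ-cell resolvent lemma: the shifted inverse `G'` has gain `γ/(1-a)` when `G` has gain `γ`
and `‖μ‖ γ ≤ a < 1` — a self-referential row estimate, no Neumann series. -/
theorem gain_resolvent (hw : ∀ m, 0 < w m) (hG : Gain w G γ) (hT : T * G = 1)
    (hG' : G' * (T + μ • (1 : Matrix (Fin n) (Fin n) ℂ)) = 1) (ha : ‖μ‖ * γ ≤ a) (ha1 : a < 1) :
    Gain w G' (γ / (1 - a)) := by
  have hid := resolvent_left hT hG'
  intro m
  set R := ∑ j, ‖G' m j‖ * w j with hR
  have hR0 : 0 ≤ R := sum_nonneg fun j _ => mul_nonneg (norm_nonneg _) (hw j).le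
  have hγ0 : 0 ≤ γ := by
    have h0 : 0 ≤ ∑ j, ‖G m j‖ * w j := sum_nonneg fun j _ => mul_nonneg (norm_nonneg _) (hw j).le
    nlinarith [hG m, hw m]
  have h1 : ∀ j, ‖G' m j‖ ≤ ‖G m j‖ + ‖μ‖ * ‖(G' * G) m j‖ := by
    intro j
    have h2 : G' m j = G m j - μ * (G' * G) m j := by
      have h3 := congrArg (fun X : Matrix (Fin n) (Fin n) ℂ => X m j) hid
      simpa [Matrix.sub_apply, Matrix.smul_apply, smul_eq_mul] using h3
    rw [h2]
    exact (norm_sub_le _ _).trans (by rw [norm_mul])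
  have hkey : R ≤ γ * w m + ‖μ‖ * γ * R := by
    calc R = ∑ j, ‖G' m j‖ * w j := hR
      _ ≤ ∑ j, (‖G m j‖ + ‖μ‖ * ‖(G' * G) m j‖) * w j :=
          sum_le_sum fun j _ => mul_le_mul_of_nonneg_right (h1 j) (hw j).le
      _ = ∑ j, ‖G m j‖ * w j + ‖μ‖ * ∑ j, ‖(G' * G) m j‖ * w j := by
          rw [mul_sum, ← sum_add_distrib]; exact sum_congr rfl fun j _ => by ring
      _ ≤ γ * w m + ‖μ‖ * (γ * ∑ k, ‖G' m k‖ * w k) :=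
          add_le_add (hG m) (mul_le_mul_of_nonneg_left (row_mul_le hw hG m) (norm_nonneg μ))
      _ = γ * w m + ‖μ‖ * γ * R := by rw [hR]; ring
  have hkey2 : R ≤ γ * w m + a * R := by nlinarith [mul_nonneg (norm_nonneg μ) hγ0]
  rw [div_mul_eq_mul_div, le_div_iff₀ (by linarith)]
  nlinarith

/-- Left difference bound: `Gain w (G A) α → Gain w ((G' - G) A) (a/(1-a) · α)`. -/
theorem gain_resolvent_diff_mul (hw : ∀ m, 0 < w m) (hG : Gain w G γ) (hT : T * G = 1)
    (hG' : G' * (T + μ • (1 : Matrix (Fin n) (Fin n) ℂ)) = 1) (ha : ‖μ‖ * γ ≤ a) (ha1 : a < 1)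
    (hGA : Gain w (G * A) α) (hα : 0 ≤ α) :
    Gain w ((G' - G) * A) (a / (1 - a) * α) := by
  have hid := resolvent_left hT hG'
  have h1 : G' - G = -(μ • (G' * G)) := by
    nth_rewrite 1 [hid]; abel
  have hd : (G' - G) * A = (-μ) • (G' * (G * A)) := by
    rw [h1, Matrix.neg_mul, Matrix.smul_mul, Matrix.mul_assoc, neg_smul]
  have h1 : Gain w (G' * (G * A)) (γ / (1 - a) * α) :=
    gain_mul hw (gain_resolvent hw hG hT hG' ha ha1) hGA hα
  have h2 := gain_smul h1 (-μ)
  rw [← hd] at h2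
  refine gain_mono hw h2 ?_
  rw [norm_neg]
  have h1a : 0 < 1 - a := by linarith
  calc ‖μ‖ * (γ / (1 - a) * α) = (‖μ‖ * γ) * α / (1 - a) := by ring
    _ ≤ a * α / (1 - a) := div_le_div_of_nonneg_right (mul_le_mul_of_nonneg_right ha hα) h1a.le
    _ = a / (1 - a) * α := by ring

/-- Right difference bound: with both-sided inverses, `Gain w (A G) α → Gain w (A (G' - G)) (α · a/(1-a))`. -/
theorem gain_mul_resolvent_diff (hw : ∀ m, 0 < w m) (hG : Gain w G γ) (hγ : 0 ≤ γ)
    (hT : T * G = 1) (hT' : G * T = 1)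
    (hG'l : G' * (T + μ • (1 : Matrix (Fin n) (Fin n) ℂ)) = 1)
    (hG'r : (T + μ • (1 : Matrix (Fin n) (Fin n) ℂ)) * G' = 1) (ha : ‖μ‖ * γ ≤ a) (ha1 : a < 1)
    (hAG : Gain w (A * G) α) (hα : 0 ≤ α) :
    Gain w (A * (G' - G)) (α * (a / (1 - a))) := by
  have hid := resolvent_right hT' hG'r
  have h0 : G' - G = -(μ • (G * G')) := by
    nth_rewrite 1 [hid]; abel
  have hd : A * (G' - G) = (-μ) • ((A * G) * G') := by
    rw [h0, Matrix.mul_neg, Matrix.mul_smul, ← Matrix.mul_assoc, neg_smul]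
  have h1a : 0 < 1 - a := by linarith
  have hγ' : 0 ≤ γ / (1 - a) := div_nonneg hγ h1a.le
  have h1 : Gain w ((A * G) * G') (α * (γ / (1 - a))) :=
    gain_mul hw hAG (gain_resolvent hw hG hT hG'l ha ha1) hγ'
  have h2 := gain_smul h1 (-μ)
  rw [← hd] at h2
  refine gain_mono hw h2 ?_
  rw [norm_neg]
  calc ‖μ‖ * (α * (γ / (1 - a))) = α * ((‖μ‖ * γ) / (1 - a)) := by ring
    _ ≤ α * (a / (1 - a)) :=
        mul_le_mul_of_nonneg_left (div_le_div_of_nonneg_right ha h1a.le) hα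

end Summit.AnomalousDissipation.SoloBlind.GainAlgebra
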